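import Summits.MatrixMultiplication.MatrixMultiplication.Theorems.FarEdgeDescentLineAntichain
import Summits.MatrixMultiplication.MatrixMultiplication.Theorems.FarEdgeDescentSpecialClass
import HarnessLib

/-!
# Pencil Gram invariants of the BCZ line, III: degeneration rigidity of the support class of MM₂

Route `FarEdgeDescent` (cell `decomp-mm`, lens 2 «structural dichotomy (special vs generic)»,
gen 39), Kernel XIV-c; support for the aside `SubLogRate` (stmt-MatrixMultiplication-25371).

Parts I–II (`FarEdgeDescentPencilGram`, `FarEdgeDescentLineAntichain`) decided the degeneration
order on the NORMAL FORMS `𝔖(q)`.  This part transports the answer to the tensors themselves,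
through the torus normal forms already in the tree (`exists_scale_fam_of_sameSupport`: a tensor
with the support `S` of `⟨2,2,2⟩` is a nowhere-zero diagonal scaling of some `𝔖(q)`, `q ≠ 0` —
Bläser–Christandl–Zuiddam, Lemma 3; `exists_scale_fam_zero`: a tensor with support `S ∖ {p₀}` is a
scaling of `𝔖(0)`), and the fact that nowhere-zero scalings are mutual restrictions
(`restrictsTo_scale`, `scale_restrictsTo`):

* `sameSupport_algDegeneratesTo_iff_restrictsTo`, `sameSupport_no_strict_degeneration`: inside
  the class `{T : supp T = S}` degeneration IS restriction and is symmetric (every field);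
* `corankOne_restrictsTo`: the class `{T : supp T = S ∖ {p₀}}` is a single `≅`-class (every field);
* `corankOne_not_algDegeneratesTo_sameSupport` (every field) and
  `sameSupport_not_algDegeneratesTo_corankOne` (char `≠ 2`, Part II): **no degeneration in either
  direction between a full-support member and a corank-one member** — in particular for `⟨2,2,2⟩`
  itself (`matMul_corankOne_incomparable`, every field);
* `closedClass_algDegeneratesTo_iff_restrictsTo`, `closedClass_no_strict_degeneration`: on the
  closed class `{supp = S} ∪ {supp = S ∖ {p₀}}` degeneration = restriction = mutual restriction
  (char `≠ 2`): the `GL`-orbit closures of its members are pairwise non-nested.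

References: M. Bläser, M. Christandl, J. Zuiddam, arXiv:1705.09652, Def. 5, Lemma 3, §2
[BlaserChristandlZuiddam2017]; P. Bürgisser, M. Clausen, M. A. Shokrollahi, *Algebraic Complexity
Theory* (1997), (15.19), (15.25), §20.2 [BurgisserClausenShokrollahi1997]; V. Strassen, J. reine
angew. Math. 384 (1988), §2 [Strassen1988].
-/

noncomputable section

open scoped BigOperators

set_option linter.dupNamespace false

namespace Summit.MatrixMultiplication.MatrixMultiplication.Theorems.FarEdgeDescentClassAntichain

open Literature.Computability.AlgebraicComplexity
open Summit.MatrixMultiplication.MatrixMultiplication.Theorems.FarEdgeDescentSignTwistDet (Leaf2)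
open Summit.MatrixMultiplication.MatrixMultiplication.Theorems.FarEdgeDescentWeightFamily
  (famW fam fam_one)
open Summit.MatrixMultiplication.MatrixMultiplication.Theorems.FarEdgeDescentWeightFamilyDet
  (fam_zero_not_algDegeneratesTo_matMul)
open Summit.MatrixMultiplication.MatrixMultiplication.Theorems.FarEdgeDescentZeroWeightBorderRank
  (fam_one_restricts)
open Summit.MatrixMultiplication.MatrixMultiplication.Theorems.FarEdgeDescentSupportClass
  (restrictsTo_scale scale_restrictsTo exists_scale_fam_of_sameSupport
    fam_eq_zero_of_fam_one_eq_zero)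
open Summit.MatrixMultiplication.MatrixMultiplication.Theorems.FarEdgeDescentSpecialClass
  (exists_scale_fam_zero fam_zero_p₀)
open Summit.MatrixMultiplication.MatrixMultiplication.Theorems.FarEdgeDescentLineRigidity
  (fam_zero_not_algDegeneratesTo_fam matMul_not_algDegeneratesTo_fam_zero)
open Summit.MatrixMultiplication.MatrixMultiplication.Theorems.FarEdgeDescentLineAntichain
  (fam_not_algDegeneratesTo_fam_zero fam_algDegeneratesTo_iff_restrictsTo no_strict_degeneration)

variable (K : Type) [Field K] {T T₀ T' T₀' : Leaf2 → (Fin 2 × Fin 2) → Leaf2 → K}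

/-! ## Transport of `⊴` along mutual restrictions -/

/-- `⊴` is invariant under mutual restriction of source and target.
[cite: BurgisserClausenShokrollahi1997, (15.25)] -/
theorem algDegeneratesTo_congr (h₁ : TensorRestrictsTo T T₀)
    (h₂ : TensorRestrictsTo T₀ T) (h₃ : TensorRestrictsTo T' T₀') (h₄ : TensorRestrictsTo T₀' T') :
    AlgDegeneratesTo T T' ↔ AlgDegeneratesTo T₀ T₀' :=
  ⟨fun h => (h₂.algDegeneratesTo_trans h).trans_restrictsTo h₃,
    fun h => (h₁.algDegeneratesTo_trans h).trans_restrictsTo h₄⟩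

/-! ## Normal forms as mutual restrictions -/

/-- **Full-support members**: `supp T = S ⟹ T ≡ 𝔖(q)` (mutual restriction) for some `q ≠ 0`.
[cite: BlaserChristandlZuiddam2017, Lemma 3] -/
theorem exists_equiv_fam_of_sameSupport (hT : SameSupport T (fam K 1)) :
    ∃ q : K, q ≠ 0 ∧ TensorRestrictsTo T (fam K q) ∧ TensorRestrictsTo (fam K q) T := by
  obtain ⟨α, β, γ, q, hα, hβ, hγ, hq, rfl⟩ := exists_scale_fam_of_sameSupport hT
  exact ⟨q, hq, scale_restrictsTo hα hβ hγ _, restrictsTo_scale α β γ _⟩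

/-- **Corank-one members**: `supp T = S ∖ {p₀} = supp 𝔖(0) ⟹ T ≡ 𝔖(0)`.
[cite: BlaserChristandlZuiddam2017, Def. 5, Lemma 3] -/
theorem equiv_fam_zero_of_sameSupport (hT : SameSupport T (fam K 0)) :
    TensorRestrictsTo T (fam K 0) ∧ TensorRestrictsTo (fam K 0) T := by
  have h1 : ∀ a x c, fam K 1 a x c = 0 → T a x c = 0 := fun a x c h => by
    by_contra hne
    exact (hT a x c).mp hne (fam_eq_zero_of_fam_one_eq_zero 0 h)
  have h0 : T (Sum.inr (1, 0)) (1, 0) (Sum.inr (0, 0)) = 0 := by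
    by_contra hne
    exact (hT _ _ _).mp hne fam_zero_p₀
  have hfull : ∀ a x c, fam K 0 a x c ≠ 0 → T a x c ≠ 0 := fun a x c h => (hT a x c).mpr h
  obtain ⟨α, β, γ, hα, hβ, hγ, e⟩ := exists_scale_fam_zero h1 h0 hfull
  rw [e]
  exact ⟨scale_restrictsTo hα hβ hγ _, restrictsTo_scale α β γ _⟩

/-! ## The full-support class (every field) -/

/-- **Inside `{supp = S}` degeneration is restriction.**
[cite: BlaserChristandlZuiddam2017, §2] [cite: BurgisserClausenShokrollahi1997, §20.2] -/
theorem sameSupport_algDegeneratesTo_iff_restrictsTo (hT : SameSupport T (fam K 1))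
    (hT' : SameSupport T' (fam K 1)) : AlgDegeneratesTo T T' ↔ TensorRestrictsTo T T' := by
  refine ⟨fun hd => ?_, fun h => h.algDegeneratesTo⟩
  obtain ⟨q, hq, h₁, h₂⟩ := exists_equiv_fam_of_sameSupport K hT
  obtain ⟨q', hq', h₃, h₄⟩ := exists_equiv_fam_of_sameSupport K hT'
  have hd' := (algDegeneratesTo_congr K h₁ h₂ h₃ h₄).mp hd
  have hr : TensorRestrictsTo (fam K q) (fam K q') :=
    (FarEdgeDescentLineRigidity.fam_algDegeneratesTo_iff_restrictsTo K fun e => absurd e hq').mp hd'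
  exact (h₁.trans hr).trans h₄

/-- **Inside `{supp = S}` there is no strict degeneration**: `T ⊵ T' ↔ T' ⊵ T`.
[cite: BurgisserClausenShokrollahi1997, §20.2] -/
theorem sameSupport_no_strict_degeneration (hT : SameSupport T (fam K 1))
    (hT' : SameSupport T' (fam K 1)) : AlgDegeneratesTo T T' ↔ AlgDegeneratesTo T' T := by
  obtain ⟨q, hq, h₁, h₂⟩ := exists_equiv_fam_of_sameSupport K hT
  obtain ⟨q', hq', h₃, h₄⟩ := exists_equiv_fam_of_sameSupport K hT'
  rw [algDegeneratesTo_congr K h₁ h₂ h₃ h₄, algDegeneratesTo_congr K h₃ h₄ h₁ h₂]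
  exact FarEdgeDescentLineRigidity.line_symmetric K (fun e => absurd e hq') fun e => absurd e hq

/-! ## The corank-one class and the mixed pairs -/

/-- **`{supp = S ∖ {p₀}}` is one `≅`-class**: any two members are mutual restrictions.
[cite: BlaserChristandlZuiddam2017, Lemma 3] -/
theorem corankOne_restrictsTo (hT : SameSupport T (fam K 0))
    (hT' : SameSupport T' (fam K 0)) : TensorRestrictsTo T T' :=
  (equiv_fam_zero_of_sameSupport K hT).1.trans (equiv_fam_zero_of_sameSupport K hT').2

/-- **A corank-one member degenerates to no full-support member** (every field).
[cite: BurgisserClausenShokrollahi1997, (15.19)] -/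
theorem corankOne_not_algDegeneratesTo_sameSupport (hT : SameSupport T (fam K 0))
    (hT' : SameSupport T' (fam K 1)) : ¬ AlgDegeneratesTo T T' := fun hd => by
  obtain ⟨h₁, h₂⟩ := equiv_fam_zero_of_sameSupport K hT
  obtain ⟨q', hq', h₃, h₄⟩ := exists_equiv_fam_of_sameSupport K hT'
  exact fam_zero_not_algDegeneratesTo_fam K hq' ((algDegeneratesTo_congr K h₁ h₂ h₃ h₄).mp hd)

/-- **A full-support member degenerates to no corank-one member** (char `K ≠ 2`; Part II).
[cite: BurgisserClausenShokrollahi1997, (15.19)] -/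
theorem sameSupport_not_algDegeneratesTo_corankOne (h2 : (2 : K) ≠ 0)
    (hT : SameSupport T (fam K 1)) (hT' : SameSupport T' (fam K 0)) : ¬ AlgDegeneratesTo T T' :=
  fun hd => by
  obtain ⟨q, hq, h₁, h₂⟩ := exists_equiv_fam_of_sameSupport K hT
  obtain ⟨h₃, h₄⟩ := equiv_fam_zero_of_sameSupport K hT'
  exact fam_not_algDegeneratesTo_fam_zero K h2 hq ((algDegeneratesTo_congr K h₁ h₂ h₃ h₄).mp hd)

/-- **`⟨2,2,2⟩` and any corank-one member are `⊴`-incomparable** (every field).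
[cite: BurgisserClausenShokrollahi1997, (15.19)] -/
theorem matMul_corankOne_incomparable (hT' : SameSupport T' (fam K 0)) :
    ¬ AlgDegeneratesTo (matMulTensor K 2 2 (1 + 1)) T' ∧
      ¬ AlgDegeneratesTo T' (matMulTensor K 2 2 (1 + 1)) := by
  obtain ⟨h₃, h₄⟩ := equiv_fam_zero_of_sameSupport K hT'
  exact ⟨fun hd => matMul_not_algDegeneratesTo_fam_zero K (hd.trans_restrictsTo h₃),
    fun hd => fam_zero_not_algDegeneratesTo_matMul K (h₄.algDegeneratesTo_trans hd)⟩

/-! ## The closed class `{supp = S} ∪ {supp = S ∖ {p₀}}` (char `≠ 2`) -/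

/-- **On the closed class degeneration is restriction** (char `≠ 2`).
[cite: BurgisserClausenShokrollahi1997, §20.2] -/
theorem closedClass_algDegeneratesTo_iff_restrictsTo (h2 : (2 : K) ≠ 0)
    (hT : SameSupport T (fam K 1) ∨ SameSupport T (fam K 0))
    (hT' : SameSupport T' (fam K 1) ∨ SameSupport T' (fam K 0)) :
    AlgDegeneratesTo T T' ↔ TensorRestrictsTo T T' := by
  refine ⟨fun hd => ?_, fun h => h.algDegeneratesTo⟩
  rcases hT with hT | hT <;> rcases hT' with hT' | hT'
  · exact (sameSupport_algDegeneratesTo_iff_restrictsTo K hT hT').mp hd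
  · exact absurd hd (sameSupport_not_algDegeneratesTo_corankOne K h2 hT hT')
  · exact absurd hd (corankOne_not_algDegeneratesTo_sameSupport K hT hT')
  · exact corankOne_restrictsTo K hT hT'

/-- **On the closed class there is no strict degeneration** (char `≠ 2`): `T ⊵ T' ↔ T' ⊵ T`; the
closed support class of `⟨2,2,2⟩` is a total `⊴`-antichain of `≅`-classes.
[cite: BurgisserClausenShokrollahi1997, §20.2] -/
theorem closedClass_no_strict_degeneration (h2 : (2 : K) ≠ 0)
    (hT : SameSupport T (fam K 1) ∨ SameSupport T (fam K 0))
    (hT' : SameSupport T' (fam K 1) ∨ SameSupport T' (fam K 0)) :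
    AlgDegeneratesTo T T' ↔ AlgDegeneratesTo T' T := by
  rcases hT with hT | hT <;> rcases hT' with hT' | hT'
  · exact sameSupport_no_strict_degeneration K hT hT'
  · exact ⟨fun hd => absurd hd (sameSupport_not_algDegeneratesTo_corankOne K h2 hT hT'),
      fun hd => absurd hd (corankOne_not_algDegeneratesTo_sameSupport K hT' hT)⟩
  · exact ⟨fun hd => absurd hd (corankOne_not_algDegeneratesTo_sameSupport K hT hT'),
      fun hd => absurd hd (sameSupport_not_algDegeneratesTo_corankOne K h2 hT' hT)⟩
  · exact ⟨fun _ => (corankOne_restrictsTo K hT' hT).algDegeneratesTo,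
      fun _ => (corankOne_restrictsTo K hT hT').algDegeneratesTo⟩

/-- **Comparable members of the closed class are mutual restrictions** (char `≠ 2`).
[cite: BurgisserClausenShokrollahi1997, §20.2] -/
theorem closedClass_comparable_iff (h2 : (2 : K) ≠ 0)
    (hT : SameSupport T (fam K 1) ∨ SameSupport T (fam K 0))
    (hT' : SameSupport T' (fam K 1) ∨ SameSupport T' (fam K 0)) :
    (AlgDegeneratesTo T T' ∨ AlgDegeneratesTo T' T) ↔
      (TensorRestrictsTo T T' ∧ TensorRestrictsTo T' T) := by
  rw [← closedClass_algDegeneratesTo_iff_restrictsTo K h2 hT hT',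
    ← closedClass_algDegeneratesTo_iff_restrictsTo K h2 hT' hT,
    ← closedClass_no_strict_degeneration K h2 hT hT', or_self, and_self]

/-- **`⟨2,2,2⟩` against the closed class** (char `≠ 2`): `⟨2,2,2⟩ ⊵ T ↔ T ⊵ ⟨2,2,2⟩ ↔ T ≡ ⟨2,2,2⟩`,
and this never happens for a corank-one `T`. [cite: BurgisserClausenShokrollahi1997, (15.19)] -/
theorem matMul_closedClass (h2 : (2 : K) ≠ 0)
    (hT : SameSupport T (fam K 1) ∨ SameSupport T (fam K 0)) :
    (AlgDegeneratesTo (matMulTensor K 2 2 (1 + 1)) T ↔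
      TensorRestrictsTo (matMulTensor K 2 2 (1 + 1)) T) ∧
    (AlgDegeneratesTo (matMulTensor K 2 2 (1 + 1)) T ↔
      AlgDegeneratesTo T (matMulTensor K 2 2 (1 + 1))) := by
  have hS : SameSupport (fam K 1) (fam K 1) ∨ SameSupport (fam K 1) (fam K 0) :=
    Or.inl fun _ _ _ => Iff.rfl
  obtain ⟨r₁, r₂⟩ := fam_one_restricts K
  have e₁ : AlgDegeneratesTo (matMulTensor K 2 2 (1 + 1)) T ↔ AlgDegeneratesTo (fam K 1) T :=
    ⟨fun hd => r₂.algDegeneratesTo_trans hd, fun hd => r₁.algDegeneratesTo_trans hd⟩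
  have e₂ : AlgDegeneratesTo T (matMulTensor K 2 2 (1 + 1)) ↔ AlgDegeneratesTo T (fam K 1) :=
    ⟨fun hd => hd.trans_restrictsTo r₁, fun hd => hd.trans_restrictsTo r₂⟩
  refine ⟨⟨fun hd => ?_, fun h => h.algDegeneratesTo⟩, ?_⟩
  · exact r₁.trans ((closedClass_algDegeneratesTo_iff_restrictsTo K h2 hS hT).mp (e₁.mp hd))
  · rw [e₁, e₂, closedClass_no_strict_degeneration K h2 hS hT]

end Summit.MatrixMultiplication.MatrixMultiplication.Theorems.FarEdgeDescentClassAntichain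

end
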